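import Summits.AtomisticToContinuum.HydrodynamicLimit.Theorems.MourreKoopmanChargesOneBodyCompletenessSplit
import Literature.MathematicalPhysics.StatisticalMechanics.DiluteHardSphereGasProofs
import HarnessLib

/-!
# `OneBodyCompleteness` · line `registered`, stub `stub_diluteGibbsStateUnit`: CLOSED

Support file for the crux item stmt-AtomisticToContinuum-9583 (`OneBodyCompleteness`, route
`MourreKoopmanCharges` of `AtomisticToContinuum/HydrodynamicLimit`), closing the registered stub
`stub_diluteGibbsStateUnit` of skeleton v5 (`Cruxes/OneBodyCompleteness/Lines/birth.lean`) —
DILUTE GIBBS STATE OF PRESCRIBED DENSITY at unit diameter and unit inverse temperature: below a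
reduced-diameter threshold `σ₁` there is a translation-invariant DLR Gibbs state of unit hard
spheres with Maxwellian `M_1` marks, activity `0 < z ≤ 2σ³` and density exactly `σ³`.

Proof: the named fact `RuelleDiluteHardSphereGas` (Ruelle 1969 Thm 4.2.3 / Thm 4.3.1: low-activity
translation-invariant DLR states with continuous density `z - Cz² ≤ ρ(z) ≤ z`) is PROVED in the
tree (`Literature.MathematicalPhysics.StatisticalMechanics.RuelleDiluteHardSphereGas_holds`,
`DiluteHardSphereGasProofs.lean`), and the landed glue `diluteGibbsStateUnit_of_ruelle`
(`…OneBodyCompletenessSplit.lean`, p155093: intermediate value theorem on `[σ³, 2σ³]` through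
`Theorems.KiferCompactification.stub_diluteGibbsStateOfFact`, at `θ = 1`, `u₀ = 0`) turns it into the
stub statement verbatim. Consequence: the v5 composition with its static half discharged,
`oneBodyCompleteness_of_packaging_identification : (packaging) → (identification) →
ChargesCompleteHS → OneBodyCompleteness` (`oneBodyCompleteness_of_ruelle` at the proved fact).

References: D. Ruelle, *Statistical Mechanics: Rigorous Results* (1969), Thm 4.2.3, Thm 4.3.1, (3.12);
R. L. Dobrushin, Ya. G. Sinai, Yu. M. Sukhov, *Dynamical systems of statistical mechanics*, Ch. 10 §2.4–2.5.
-/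

noncomputable section

namespace Summit.AtomisticToContinuum.HydrodynamicLimit.Theorems.MourreKoopmanChargesOneBodyCompleteness

open scoped Topology InnerProductSpace
open Filter MeasureTheory ProbabilityTheory

/-- **Registered stub `stub_diluteGibbsStateUnit` (CLOSED)**: below a reduced-diameter threshold
`σ₁` there is a translation-invariant DLR Gibbs state of unit hard spheres with `M_1` marks, activity
`0 < z ≤ 2σ³` and density exactly `σ³` — Ruelle's low-activity gas (`RuelleDiluteHardSphereGas_holds`)
through the intermediate value theorem (`diluteGibbsStateUnit_of_ruelle`).
[cite: Ruelle1969, Thm 4.2.3 and Thm 4.3.1] -/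
theorem stub_diluteGibbsStateUnit :
    ∃ σ₁ : ℝ, 0 < σ₁ ∧ ∀ σ : ℝ, 0 < σ → σ < σ₁ →
      ∃ (z : ℝ) (G : MeasureTheory.Measure Literature.MathematicalPhysics.KineticTheory.MarkedConfig),
        0 < z ∧ z ≤ 2 * σ ^ 3 ∧
        Literature.Analysis.FluidPDE.IsHardSphereGibbs 1 z 1
          (0 : Literature.MathematicalPhysics.KineticTheory.V3) G ∧
        Literature.Analysis.FluidPDE.IsTranslationInvariant G ∧
        Literature.MathematicalPhysics.KineticTheory.PointProcess.density G = ENNReal.ofReal (σ ^ 3) :=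
  diluteGibbsStateUnit_of_ruelle
    Literature.MathematicalPhysics.StatisticalMechanics.RuelleDiluteHardSphereGas_holds

/-- **The v5 composition with the static half discharged** (UNCONDITIONAL in the Gibbs state): the
dynamical packaging of dilute unit-diameter Gibbs states as fluctuation data, the unit-diameter
diagonal torus ↔ infinite-volume identification, and the route item `ChargesCompleteHS`
(stmt-AtomisticToContinuum-14141) imply the crux `MourreKoopmanCharges.OneBodyCompleteness` BY NAME
(`oneBodyCompleteness_of_ruelle` at `RuelleDiluteHardSphereGas_holds`). [folklore] -/
theorem oneBodyCompleteness_of_packaging_identification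
    (h1b : ∃ σ₃ : ℝ, 0 < σ₃ ∧ ∀ σ : ℝ, 0 < σ → σ < σ₃ → ∀ z : ℝ, 0 < z → z ≤ 2 * σ ^ 3 →
      ∀ G : MeasureTheory.Measure Literature.MathematicalPhysics.KineticTheory.MarkedConfig,
        Literature.Analysis.FluidPDE.IsHardSphereGibbs 1 z 1
          (0 : Literature.MathematicalPhysics.KineticTheory.V3) G →
        Literature.Analysis.FluidPDE.IsTranslationInvariant G →
        Literature.MathematicalPhysics.KineticTheory.PointProcess.density G = ENNReal.ofReal (σ ^ 3) →
        ∃ F : Literature.MathematicalPhysics.KineticTheory.HardSphereFluctuationData 1,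
          F.μ = G ∧
          (∃ Φ : Literature.Analysis.FluidPDE.InfiniteHardSphereFlow (Fin 3) 1,
            Φ.IsEquilibriumFlow ∧ ∀ t : ℝ, F.flow t =ᵐ[F.μ] Φ.flow t) ∧
          (∀ ψ : Literature.MathematicalPhysics.KineticTheory.HardSphereFluctuationSpace F,
            Continuous fun t : ℝ => F.koopman t ψ) ∧
          (∀ g : Literature.MathematicalPhysics.KineticTheory.V3 → ℝ, Continuous g →
            (∃ (C : ℝ) (k : ℕ), ∀ v, |g v| ≤ C * (1 + ‖v‖) ^ k) →
            Literature.MathematicalPhysics.KineticTheory.cellObs g ∈ F.localObs))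
    (h2 : ∃ z₂ : ℝ, 0 < z₂ ∧ ∀ σ : ℝ, 0 < σ → σ < 1 / 2 → ∀ z : ℝ, 0 < z → z < z₂ → ∀ θ : ℝ, 0 < θ →
      ∀ F : Literature.MathematicalPhysics.KineticTheory.HardSphereFluctuationData 1,
        Literature.Analysis.FluidPDE.IsHardSphereGibbs 1 z 1
          (0 : Literature.MathematicalPhysics.KineticTheory.V3) F.μ →
        (∃ Φ : Literature.Analysis.FluidPDE.InfiniteHardSphereFlow (Fin 3) 1,
          Φ.IsEquilibriumFlow ∧ ∀ t : ℝ, F.flow t =ᵐ[F.μ] Φ.flow t) →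
        (∫ ω, Literature.MathematicalPhysics.KineticTheory.cellCharge 0 ω ∂F.μ = σ ^ 3) →
        ∀ h : Literature.MathematicalPhysics.KineticTheory.V3 → ℝ, Continuous h →
          (∃ (C : ℝ) (k : ℕ), ∀ v, |h v| ≤ C * (1 + ‖v‖) ^ k) →
          Literature.MathematicalPhysics.KineticTheory.cellObs (fun w => h (Real.sqrt θ • w)) ∈ F.localObs →
          (∫ v, h v * Literature.Analysis.FluidPDE.localMaxwellian 1 θ
              (0 : Literature.MathematicalPhysics.KineticTheory.V3) v = 0) →
          (∀ i : Fin 3, ∫ v, h v * v i * Literature.Analysis.FluidPDE.localMaxwellian 1 θ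
              (0 : Literature.MathematicalPhysics.KineticTheory.V3) v = 0) →
          (∫ v, h v * ‖v‖ ^ 2 * Literature.Analysis.FluidPDE.localMaxwellian 1 θ
              (0 : Literature.MathematicalPhysics.KineticTheory.V3) v = 0) →
          ∃ K : ℝ, ∀ Φ : (N : ℕ) → Literature.Analysis.FluidPDE.HardSphereFlow
              (Literature.Analysis.FluidPDE.Torus.geometry (Fin 3))
              (Literature.MathematicalPhysics.KineticTheory.hsDiameter σ N) (N + 1),
          ∀ χ : Literature.MathematicalPhysics.KineticTheory.T3 → ℝ, Continuous χ → ∀ s : ℝ,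
            Tendsto (fun N : ℕ => ((N : ℝ) + 1) *
                cov[fun z => ∫ y, χ y.1 * h y.2 ∂(Literature.Analysis.FluidPDE.empiricalMeasure
                      ((Φ N).flow (s * ((N : ℝ) + 1) ^ (-(1 / 3 : ℝ))) z)),
                    fun z => ∫ y, χ y.1 * h y.2 ∂(Literature.Analysis.FluidPDE.empiricalMeasure z);
                  Literature.MathematicalPhysics.KineticTheory.localGibbsLaw σ (fun _ => 1)
                    (fun _ => 0) (fun _ => θ) N (Φ N)])
              atTop (𝓝 ((∫ x, χ x * χ x) * K *
                ⟪F.koopman (Real.sqrt θ / σ * s)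
                    (F.fluct (Literature.MathematicalPhysics.KineticTheory.cellObs
                      (fun w => h (Real.sqrt θ • w)))),
                  F.fluct (Literature.MathematicalPhysics.KineticTheory.cellObs
                    (fun w => h (Real.sqrt θ • w)))⟫_ℝ)))
    (h3 : Summit.AtomisticToContinuum.HydrodynamicLimit.Theses.MourreKoopmanCharges.ChargesCompleteHS) :
    Summit.AtomisticToContinuum.HydrodynamicLimit.Theses.MourreKoopmanCharges.OneBodyCompleteness :=
  oneBodyCompleteness_of_ruelle
    Literature.MathematicalPhysics.StatisticalMechanics.RuelleDiluteHardSphereGas_holds h1b h2 h3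

end Summit.AtomisticToContinuum.HydrodynamicLimit.Theorems.MourreKoopmanChargesOneBodyCompleteness

end
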